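import Summits.FinalStateConjecture.FinalStateConjecture.Theorems.ZeroEnergyKerrOrBombStationaryLimitReductionRecutCoveringJunctionCore
import HarnessLib

/-!
# Route ZeroEnergyKerrOrBomb · crux `FinalStateFromKerrOrBomb` (stmt-FinalStateConjecture-17839), line `SketchIdeator1` —
# stub `stub_recutJunctionCoreB` (m5, boost-honest junction core), wave 7: the BOOSTED / ISOCHRONOUS DICHOTOMY of a hole
# (sub-case F1b of Step F) and slab membership of Kerr–Schild slab points

Helper file (`--supports stmt-FinalStateConjecture-17839`; registered helpers `lorentz_map_basisVector_of_apply_zero_eq_one`,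
`recutJunction_time_le_labTime_sub`, `chart_mem_recutCertifiedSlab_of_kerr`) of the lead's wave-7 stub worker W18
(2026-08-17); companion of `…RecutCoreBLorentz.lean` (p153600: `γᵢ ≥ 1`, B1a/B1b) and `…RecutCoreBDeepExit.lean` (p153924).
Plan `work/stubs/W17-boost-audit.md` §7.2, Step F (F1b); report `work/stubs/W18-report.md`.

With `γᵢ := (Λᵢ e₀)⁰ ≥ 1` (orthochrony, `recutJunction_orthochronous`) every hole is EITHER isochronous — `γᵢ = 1`, and then
`Λᵢ e₀ = e₀` exactly (`lorentz_map_basisVector_of_apply_zero_eq_one`: `‖(Λᵢ⁻¹ e₀)_{space}‖² = γᵢ² − 1 = 0`), so the wave-5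
exact-transport lemmas (`poincareInv_add_smul_basisVector_of_map_basisVector`, `kerr_apply_add_smul`, p146004) apply to it —
OR boosted, `γᵢ > 1`, and then the rest time of its certified coordinates LAGS the lab time by any prescribed amount:
for every `K`, eventually in the lab time `y⁰`, `radiusᵢ y ≤ Rᵢ (timeᵢ y)` implies `timeᵢ y ≤ y⁰ − K`
(`recutJunction_time_le_labTime_sub`; Lorentz sandwich + sublinear radii: `(γᵢ − 1) t − uᵢ Rᵢ t → ∞`). Hence the sub-case
"Kerr–Schild time of the exit point `> τ₁` although its lab time is `≤ τ₁`" (F1b) occurs only for isochronous holes. Finally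
(`chart_mem_recutCertifiedSlab_of_kerr`, plumbing P2): the old chart point of `Pᵢ Θᵢ x` with Kerr–Schild time EXACTLY `τ₁` and
Kerr–Schild radius `≤ R'ᵢ τ₁` is a point of `recutCertifiedSlab d M a Θ R' τ₁` (definitional). Elementary; no named fact,
nothing restated. References: O'Neill 1983, Ch. 9, pp. 233–236; Dafermos–Luk arXiv:1710.01722, Conjecture 1 (b)–(c).
-/

set_option linter.dupNamespace false
set_option maxSynthPendingDepth 3

noncomputable section

open scoped Manifold ContDiff Topology RealInnerProductSpace
open Set Filter Function

namespace Summit.FinalStateConjecture.FinalStateConjecture.Theorems.SymplecticDualOfTheBomb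

open Literature.Geometry.Lorentzian Summit.FinalStateConjecture.FinalStateConjecture.Theorems.OneLockedExplosion

/-! ## §1 Lorentz algebra (private copies of brick B1, p152127, module unbuilt today) -/

section Lorentz

variable (Λ : lorentzGroup)

/-- `η(v, w) = −v⁰ w⁰ + ⟪v_{space}, w_{space}⟫`. O'Neill 1983, Ch. 3, p. 55. [folklore] -/
private theorem minkowski_eq_inner_w7c (v w : E4) :
    Minkowski.bilin v w = -(v 0 * w 0) + ⟪E4.spatial v, E4.spatial w⟫ := by
  -- private copy of `minkowski_eq_inner_w17` (…BoostAuditLorentz, unbuilt today)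
  rw [Minkowski.bilin_apply, real_inner_comm, PiLp.inner_apply]
  simp [Fin.sum_univ_three, E4.spatial_apply]

/-- `(e₀)_{space} = 0`. [folklore] -/
private theorem spatial_basisVector_zero_w7c : E4.spatial (E4.basisVector 0) = 0 := by
  ext i
  simp [E4.basisVector]

/-- `(e₀)⁰ = 1`. [folklore] -/
private theorem basisVector_zero_apply_zero_w7c : (E4.basisVector 0 : E4) 0 = 1 := by
  simp [E4.basisVector]

/-- `(Λ w)⁰ = ũ⁰ w⁰ − ⟪ũ_{space}, w_{space}⟫`, `ũ := Λ⁻¹ e₀`. O'Neill 1983, Ch. 9, p. 233. [folklore] -/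
private theorem lorentz_apply_zero_eq_w7c (w : E4) :
    (Λ : E4 ≃L[ℝ] E4) w 0 = (Λ : E4 ≃L[ℝ] E4).symm (E4.basisVector 0) 0 * w 0 -
      ⟪E4.spatial ((Λ : E4 ≃L[ℝ] E4).symm (E4.basisVector 0)), E4.spatial w⟫ := by
  -- private copy of `lorentz_apply_zero_eq_w17` (…BoostAuditLorentz, unbuilt today)
  have h := Λ.2 ((Λ : E4 ≃L[ℝ] E4).symm (E4.basisVector 0)) w
  rw [ContinuousLinearEquiv.apply_symm_apply, Minkowski.bilin_basisVector_zero_left, minkowski_eq_inner_w7c] at h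
  linarith

/-- `(Λ⁻¹ e₀)⁰ = (Λ e₀)⁰`. O'Neill 1983, Ch. 9, p. 233. [folklore] -/
private theorem lorentz_symm_basisVector_apply_zero_w7c :
    (Λ : E4 ≃L[ℝ] E4).symm (E4.basisVector 0) 0 = (Λ : E4 ≃L[ℝ] E4) (E4.basisVector 0) 0 := by
  -- private copy of `lorentz_symm_basisVector_apply_zero` (…BoostAuditLorentz, unbuilt today)
  have h := lorentz_apply_zero_eq_w7c Λ (E4.basisVector 0)
  rw [spatial_basisVector_zero_w7c, inner_zero_right, sub_zero, basisVector_zero_apply_zero_w7c, mul_one] at h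
  exact h.symm

/-- `‖(Λ⁻¹ e₀)_{space}‖² = ((Λ e₀)⁰)² − 1`. O'Neill 1983, Ch. 9, p. 233. [folklore] -/
private theorem lorentz_symm_basisVector_spatialNorm_sq_w7c :
    E4.spatialNorm ((Λ : E4 ≃L[ℝ] E4).symm (E4.basisVector 0)) ^ 2 =
      ((Λ : E4 ≃L[ℝ] E4) (E4.basisVector 0) 0) ^ 2 - 1 := by
  -- private copy of `lorentz_symm_basisVector_spatialNorm_sq` (…BoostAuditLorentz, unbuilt today)
  have h := Λ.2 ((Λ : E4 ≃L[ℝ] E4).symm (E4.basisVector 0)) ((Λ : E4 ≃L[ℝ] E4).symm (E4.basisVector 0))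
  rw [ContinuousLinearEquiv.apply_symm_apply, Minkowski.bilin_basisVector_zero, minkowski_eq_inner_w7c,
    real_inner_self_eq_norm_sq, lorentz_symm_basisVector_apply_zero_w7c] at h
  rw [E4.spatialNorm]
  linarith

/-- `|(Λ⁻¹(x − c))⁰ γ − (x⁰ − c⁰)| ≤ √(γ² − 1) ‖(Λ⁻¹(x − c))_{space}‖`. O'Neill 1983, Ch. 9, p. 236. [folklore] -/
private theorem poincareInv_time_sandwich_w7c (c x : E4) :
    |x 0 - c 0 - (Λ : E4 ≃L[ℝ] E4) (E4.basisVector 0) 0 * poincareInv Λ c x 0| ≤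
      √(((Λ : E4 ≃L[ℝ] E4) (E4.basisVector 0) 0) ^ 2 - 1) * E4.spatialNorm (poincareInv Λ c x) := by
  -- private copy of `poincareInv_time_sandwich` (…BoostAuditLorentz, p152127, unbuilt today)
  set w : E4 := poincareInv Λ c x with hw
  have hx : x 0 - c 0 = (Λ : E4 ≃L[ℝ] E4) w 0 := by
    have h1 : (Λ : E4 ≃L[ℝ] E4) w = x - c := by rw [hw, poincareInv, ContinuousLinearEquiv.apply_symm_apply]
    rw [h1, PiLp.sub_apply]
  have hsp : E4.spatialNorm ((Λ : E4 ≃L[ℝ] E4).symm (E4.basisVector 0)) =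
      √(((Λ : E4 ≃L[ℝ] E4) (E4.basisVector 0) 0) ^ 2 - 1) := by
    rw [← lorentz_symm_basisVector_spatialNorm_sq_w7c, Real.sqrt_sq (E4.spatialNorm_nonneg _)]
  rw [hx, lorentz_apply_zero_eq_w7c, lorentz_symm_basisVector_apply_zero_w7c, ← hsp]
  have h := abs_real_inner_le_norm (E4.spatial ((Λ : E4 ≃L[ℝ] E4).symm (E4.basisVector 0))) (E4.spatial w)
  rw [show (Λ : E4 ≃L[ℝ] E4) (E4.basisVector 0) 0 * w 0 -
      ⟪E4.spatial ((Λ : E4 ≃L[ℝ] E4).symm (E4.basisVector 0)), E4.spatial w⟫ -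
        (Λ : E4 ≃L[ℝ] E4) (E4.basisVector 0) 0 * w 0 =
      -⟪E4.spatial ((Λ : E4 ≃L[ℝ] E4).symm (E4.basisVector 0)), E4.spatial w⟫ by ring, abs_neg]
  simpa [E4.spatialNorm] using h

/-- A vector of `E4` with vanishing spatial part is `u⁰ e₀`. [folklore] -/
private theorem eq_smul_basisVector_of_spatial_eq_zero_w7c {u : E4} (hsp : E4.spatial u = 0) :
    u = u 0 • E4.basisVector 0 := by
  -- private copy of `eq_smul_basisVector_of_spatial_eq_zero` (…RecutCoreCOIsochronousSign, unbuilt today)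
  have h := E4.ofTimeSpace_time_spatial u
  rw [hsp, E4.time_apply, ← E4.ofTimeSpace_zero_add_smul (0 : E3) (u 0)] at h
  have h0 : E4.ofTimeSpace 0 (0 : E3) = 0 := by
    ext j
    refine Fin.cases ?_ (fun i ↦ ?_) j <;> simp
  rw [h0, zero_add] at h
  exact h.symm

/-- **Registered helper `lorentz_map_basisVector_of_apply_zero_eq_one`**: a Lorentz transformation with Lorentz factor
`(Λ e₀)⁰ = 1` fixes the time axis, `Λ e₀ = e₀` (`‖(Λ⁻¹e₀)_{space}‖² = γ² − 1 = 0` and `(Λ⁻¹e₀)⁰ = γ = 1`): the isochronous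
branch of the dichotomy, under which the wave-5 exact-transport lemmas apply to the hole. O'Neill 1983, Ch. 9, p. 233.
[folklore] -/
theorem lorentz_map_basisVector_of_apply_zero_eq_one : ∀ (Λ : lorentzGroup), (Λ : E4 ≃L[ℝ] E4) (E4.basisVector 0) 0 = 1 → (Λ : E4 ≃L[ℝ] E4) (E4.basisVector 0) = E4.basisVector 0 := by
  intro Λ hγ
  have hsq := lorentz_symm_basisVector_spatialNorm_sq_w7c Λ
  rw [hγ, one_pow, sub_self] at hsq
  have hsp : E4.spatial ((Λ : E4 ≃L[ℝ] E4).symm (E4.basisVector 0)) = 0 := by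
    have h : E4.spatialNorm ((Λ : E4 ≃L[ℝ] E4).symm (E4.basisVector 0)) = 0 := by
      nlinarith [E4.spatialNorm_nonneg ((Λ : E4 ≃L[ℝ] E4).symm (E4.basisVector 0))]
    rwa [E4.spatialNorm, norm_eq_zero] at h
  have hu := eq_smul_basisVector_of_spatial_eq_zero_w7c hsp
  rw [lorentz_symm_basisVector_apply_zero_w7c, hγ, one_smul] at hu
  have h := congrArg (Λ : E4 ≃L[ℝ] E4) hu
  rw [ContinuousLinearEquiv.apply_symm_apply] at h
  exact h.symm

end Lorentz

/-! ## §2 Boosted holes: the rest time of certified coordinates lags the lab time -/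

section Boosted

variable {𝓢 : Spacetime.{0} 4} {O : Set 𝓢.carrier} {k : ℕ}

/-- **Registered helper `recutJunction_time_le_labTime_sub` (brick B1b′, W17 §7.2 F1b)**: for a BOOSTED hole (`γᵢ > 1`) with
monotone SUBLINEAR radii and every `K`, eventually in the lab time `y⁰`, every certified coordinate `y` of hole `i`
(`radiusᵢ y ≤ Rᵢ (timeᵢ y)`) has `timeᵢ y ≤ y⁰ − K` (`γᵢ t − uᵢ (Rᵢ t + C) ≤ y⁰ − cᵢ⁰` and `(γᵢ − 1) t − uᵢ Rᵢ t → ∞`). So an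
exit point of lab time `≤ τ₁` has Kerr–Schild time `≤ τ₁ − K + L < τ₁`: sub-case F1b is void for boosted holes. [folklore] -/
theorem recutJunction_time_le_labTime_sub : ∀ {𝓢 : Spacetime.{0} 4} {O : Set 𝓢.carrier} {k : ℕ} (d : StationaryFinalStateDecomposition 𝓢 O k) (R : Fin d.N → ℝ → ℝ) (i : Fin d.N), Monotone (R i) → Tendsto (fun τ ↦ R i τ / τ) atTop (𝓝 0) → 1 < ((d.motion i).1 : E4 ≃L[ℝ] E4) (E4.basisVector 0) 0 → ∀ K : ℝ, ∃ T : ℝ, ∀ y : E4, T ≤ y 0 → (d.background i).radius y ≤ R i ((d.background i).time y) → (d.background i).time y ≤ y 0 - K := by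
  intro 𝓢 O k d R i hRmono hRo hγ1 K
  obtain ⟨C', hC'⟩ := (d.adapted i).exists_abs_radius_sub_spatialNorm_le
  set C : ℝ := |C'| with hC_def
  have hC0 : 0 ≤ C := abs_nonneg _
  set γ : ℝ := ((d.motion i).1 : E4 ≃L[ℝ] E4) (E4.basisVector 0) 0 with hγ
  set u : ℝ := √(γ ^ 2 - 1) with hu
  have hu0 : 0 ≤ u := Real.sqrt_nonneg _
  set c₀ : ℝ := (d.motion i).2 0 with hc₀
  -- the pointwise sandwich, lower half: `γ t − u (radius + C) ≤ y⁰ − c⁰`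
  have hsand : ∀ y : E4, γ * (d.background i).time y - u * ((d.background i).radius y + C) ≤ y 0 - c₀ := fun y ↦ by
    have h := (abs_le.1 (poincareInv_time_sandwich_w7c (d.motion i).1 (d.motion i).2 y)).1
    have h1 : E4.spatialNorm (poincareInv (d.motion i).1 (d.motion i).2 y) ≤
        (d.adapted i).radius (poincareInv (d.motion i).1 (d.motion i).2 y) + C := by
      have h2 := (abs_le.1 (hC' (poincareInv (d.motion i).1 (d.motion i).2 y))).1
      linarith [le_abs_self C']
    have h3 := mul_le_mul_of_nonneg_left h1 hu0
    show γ * poincareInv (d.motion i).1 (d.motion i).2 y 0 -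
      u * ((d.adapted i).radius (poincareInv (d.motion i).1 (d.motion i).2 y) + C) ≤ y 0 - c₀
    linarith
  -- a rest-time threshold `T₁` beyond which `u (R t + C) ≤ (γ − 1) t − (K − c₀)`
  have hg : 0 < γ - 1 := by linarith
  have hδ : 0 < (γ - 1) / (2 * (u + 1)) := by positivity
  have h2 : ∀ᶠ t in atTop, |R i t / t| ≤ (γ - 1) / (2 * (u + 1)) := by
    have h := (Metric.tendsto_nhds.1 hRo) _ hδ
    filter_upwards [h] with t ht
    rw [Real.dist_eq, sub_zero] at ht
    exact ht.le
  obtain ⟨T₁, hT₁⟩ := eventually_atTop.1 (h2.and ((eventually_gt_atTop (0 : ℝ)).and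
    (eventually_ge_atTop (2 * (u * C + |K - c₀|) / (γ - 1)))))
  have hthr : ∀ t, T₁ ≤ t → u * (R i t + C) ≤ (γ - 1) * t - (K - c₀) := fun t ht ↦ by
    obtain ⟨h3, ht0, ht1⟩ := hT₁ t ht
    have h4 : |R i t| ≤ (γ - 1) / (2 * (u + 1)) * t := by
      rw [abs_div, abs_of_pos ht0, div_le_iff₀ ht0] at h3
      exact h3
    have h5 : u * R i t ≤ (γ - 1) * t / 2 := by
      have h6 : u * R i t ≤ u * |R i t| := mul_le_mul_of_nonneg_left (le_abs_self _) hu0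
      have h7 : u * |R i t| ≤ (u + 1) * |R i t| := by nlinarith [abs_nonneg (R i t)]
      have h8 : (u + 1) * ((γ - 1) / (2 * (u + 1)) * t) = (γ - 1) * t / 2 := by field_simp
      nlinarith [mul_le_mul_of_nonneg_left h4 (by positivity : (0 : ℝ) ≤ u + 1)]
    have h9 : u * C + |K - c₀| ≤ (γ - 1) * t / 2 := by
      rw [div_le_iff₀ hg] at ht1
      linarith
    linarith [le_abs_self (K - c₀)]
  refine ⟨T₁ + |K|, fun y hy hcert ↦ ?_⟩
  set t : ℝ := (d.background i).time y with ht
  by_cases hcase : t < T₁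
  · linarith [le_abs_self K]
  · push Not at hcase
    have h1 := hsand y
    rw [← ht] at h1
    have h2 : u * ((d.background i).radius y + C) ≤ u * (R i t + C) :=
      mul_le_mul_of_nonneg_left (by linarith) hu0
    have h3 := hthr t hcase
    linarith

end Boosted

/-! ## §3 Slab membership of Kerr–Schild slab points (plumbing P2) -/

section Slab

variable {𝓢 : Spacetime.{0} 4} {O : Set 𝓢.carrier} {k : ℕ}

/-- **Registered helper `chart_mem_recutCertifiedSlab_of_kerr` (plumbing P2, W17 §7.2 F1b)**: the old chart point of the
moved identification point `Pᵢ (Θᵢ x)` of a Kerr–Schild point `x ∈ Kerr.exterior` with Kerr–Schild time EXACTLY `τ₁` and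
Kerr–Schild radius `r(x) ≤ R'ᵢ τ₁` lies in `recutCertifiedSlab d M a Θ R' τ₁` (definitional unfolding of `recutImage` of the
truncated boosted Kerr–Schild slab). [folklore] -/
theorem chart_mem_recutCertifiedSlab_of_kerr : ∀ {𝓢 : Spacetime.{0} 4} {O : Set 𝓢.carrier} {k : ℕ} (d : StationaryFinalStateDecomposition 𝓢 O k) (M a : Fin d.N → ℝ) (Θ : Fin d.N → E4 → E4) (R' : Fin d.N → ℝ → ℝ) (τ₁ : ℝ) (i : Fin d.N) (x : E4), x ∈ (Kerr.exterior (M i) (a i) : Set E4) → x 0 = τ₁ → Kerr.radius (a i) x ≤ R' i τ₁ → ∀ h₀ : ((d.motion i).1 : E4 ≃L[ℝ] E4) (Θ i x) + (d.motion i).2 ∈ (d.background i).domain, d.toOver.chart i ⟨((d.motion i).1 : E4 ≃L[ℝ] E4) (Θ i x) + (d.motion i).2, h₀⟩ ∈ recutCertifiedSlab d M a Θ R' τ₁ := by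
  -- adapted from `chart_mem_recutCertifiedLate_of_kerr` (…RecutCoreCOFlatSteer, p146004, unbuilt today)
  intro 𝓢 O k d M a Θ R' τ₁ i x hx hx0 hxr h₀
  set z : E4 := ((d.motion i).1 : E4 ≃L[ℝ] E4) x + (d.motion i).2 with hz
  have hPz : poincareInv (d.motion i).1 (d.motion i).2 z = x := poincareInv_apply_add _ _ _
  have hzdom : z ∈ ((recutBackground d M a i).domain : Set E4) := by
    show poincareInv (d.motion i).1 (d.motion i).2 z ∈ (Kerr.exterior (M i) (a i) : Set E4)
    rw [hPz]; exact hx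
  refine Or.inr (mem_iUnion.2 ⟨i, mem_image_of_mem _ ?_⟩)
  refine ⟨z, ⟨⟨z, hzdom⟩, ⟨?_, ?_⟩, rfl⟩, ?_⟩
  · show (poincareInv (d.motion i).1 (d.motion i).2 z) 0 = τ₁
    rw [hPz]; exact hx0
  · show Kerr.radius (a i) (poincareInv (d.motion i).1 (d.motion i).2 z) ≤ R' i τ₁
    rw [hPz]; exact hxr
  · show ((d.motion i).1 : E4 ≃L[ℝ] E4) (Θ i (poincareInv (d.motion i).1 (d.motion i).2 z)) + (d.motion i).2 = _
    rw [hPz]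

end Slab

end Summit.FinalStateConjecture.FinalStateConjecture.Theorems.SymplecticDualOfTheBomb

end
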